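import Literature.Computability.AlgebraicComplexity.GlobalStagePresent
import HarnessLib

/-!
# Asymmetric hashing and cleanup for an arbitrary family of level triples with bounded degrees
(Vassilevska Williams–Xu–Xu–Zhou 2024, §6.2, Claims 6.6–6.8: "analogous to the claims in §5 … we
omit their proofs") — proved

Topic `Literature/Computability/AlgebraicComplexity`.  §6.2 of Vassilevska Williams–Xu–Xu–Zhou,
*New bounds for matrix multiplication: from alpha to omega* (SODA 2024, arXiv:2307.07970) hashes the
level-`(ℓ−1)` block triples remaining inside a level-`ℓ` interface tensor with the hash family of §5.2
(on index sequences of length `2n`) and cleans the buckets asymmetrically, under the requirement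
`M₀ ≥ 8 · max{numtriple/numxblock, numtriple/numyblock}`; Claims 6.6 (bucket probabilities `1/M²`,
`1/M`), 6.7 (survival probability `≥ 3/4`) and 6.8 (expected number of surviving triples
`≥ numalpha · M₀^{−1−o(1)}`) "still hold, and we omit their proofs".  The tree's §5 versions
(`AsymmetricCleanup.lean`, Claims 5.5–5.7; `GlobalStagePresent.lean`) are stated for the family
`𝒯 = typedSupport (levelSupport P) n μX μY μZ` of triples with prescribed MARGINAL types, whose
`X`-degree is `numtriple/numxblock` by the symmetry of `S_n`.  In §6 the family (triples of
level-`(ℓ−1)` blocks with prescribed per-term PAIR types) and its symmetry group (chunk permutations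
within the terms) are different, so this file PROVES the three claims once and for all for an
ARBITRARY finite family `𝒯` of level triples (`I_p + J_p + K_p = P` at every position) in terms of
its `X`- and `Y`-degrees:

* `IsLevelFamily`, `.snd_ne_of_fst_eq`, `.card_seeds_inBucket`, `.card_seeds_inBucket_shareX/Y` —
  **Claim 6.6** (= Claim 5.5 for the family): `M^n` seeds put a triple into a bucket, `M^{n−1}` put it
  there together with another triple sharing its `X`- (or `Y`-) block;
* `vxxz2024_claim67` — **Claim 6.7**: if `8 · deg_X(T) ≤ M` and `8 · deg_Y(T) ≤ M`
  (`deg_X(T) = #{T' ∈ 𝒯 | T'.1 = T.1}`), then `3 M^n ≤ 4 · #{ω | T survives in bucket b}`;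
* `vxxz2024_claim68`, `vxxz2024_claim68_exists` — **Claim 6.8**: summed over `𝒯α ⊆ 𝒯` and `b ∈ B`,
  `3 |B| |𝒯α| M^n ≤ 4 ∑_ω #{(b,T) surviving}`, and some seed has
  `3 |B| |𝒯α| ≤ 4 M² · #{T ∈ 𝒯α surviving in some bucket of B}`;
* `IsLevelFamily.inBucket_of_mem_hashPresent`, `IsLevelFamily.presentTriples_eq_filter_survives` —
  the present triples `𝒯'` (`GlobalStagePresent.presentTriples`, generic in `𝒯`) are the
  `α`-consistent triples surviving in some bucket of a 3-AP-free `B`;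
* `isLevelFamily_typedSupport` — the §5 family is a level family (so the §5 statements are the
  special case `deg_X = numtriple/numxblock`, `AsymmetricCleanup.degX_mul_card_typeClass`).

Everything is proved; one definition (`IsLevelFamily`); no named facts.

## References

* V. Vassilevska Williams, Y. Xu, Z. Xu, R. Zhou, *New bounds for matrix multiplication: from alpha
  to omega*, SODA 2024, arXiv:2307.07970 (held: `paper:arxiv-2307.07970`), §6.2 (hashing, the
  requirement on `M₀`, Claims 6.6–6.8) and §5.2 (Claims 5.5–5.7, whose proofs they follow).
  [VassilevskaWilliamsXuXuZhou2024]
-/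

open scoped BigOperators
open Finset

namespace Literature.Computability.AlgebraicComplexity

/-! ## Families of level triples -/

section LevelFamily

variable {n P : ℕ}

/-- **A family of level triples**: at every position the three block indices sum to `P = 2^{ℓ'}`
(the block triples of any zero-out of `(CW_q^{⊗2^{ℓ'−1}})^{⊗n}` read at level `ℓ'`).
[cite: VassilevskaWilliamsXuXuZhou2024, §6.2 ("the remaining level-(ℓ−1) block triples X_I Y_J Z_K") and §3.8] -/
def IsLevelFamily (P : ℕ) (𝒯 : Finset ((Fin n → Fin (P + 1)) × (Fin n → Fin (P + 1)) × (Fin n → Fin (P + 1)))) : Prop :=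
  ∀ T ∈ 𝒯, ∀ t, seqVal T.1 t + seqVal T.2.1 t + seqVal T.2.2 t = P

/-- The §5 family of triples with prescribed marginal types is a level family. [cite: VassilevskaWilliamsXuXuZhou2024, §5.2] -/
theorem isLevelFamily_typedSupport (μX μY μZ : Fin (P + 1) → ℕ) :
    IsLevelFamily P (typedSupport (levelSupport P) n μX μY μZ) :=
  fun _ hT t => levelSum_of_mem_typedSupport hT t

/-- A subfamily of a level family is a level family. [folklore] -/
theorem IsLevelFamily.mono {𝒯 𝒯' : Finset ((Fin n → Fin (P + 1)) × (Fin n → Fin (P + 1)) × (Fin n → Fin (P + 1)))}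
    (h : IsLevelFamily P 𝒯) (h' : 𝒯' ⊆ 𝒯) : IsLevelFamily P 𝒯' :=
  fun T hT t => h T (h' hT) t

/-- Two different triples of a level family sharing the `X`-block have different `Y`-blocks (the
`Z`-block is determined). [cite: VassilevskaWilliamsXuXuZhou2024, Claim 6.6 ("two different block triples X_I Y_J Z_K, X_I Y_{J'} Z_{K'} ∈ 𝒯 that share the same X-block")] -/
theorem IsLevelFamily.snd_ne_of_fst_eq {𝒯 : Finset ((Fin n → Fin (P + 1)) × (Fin n → Fin (P + 1)) × (Fin n → Fin (P + 1)))}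
    (h𝒯 : IsLevelFamily P 𝒯) {T T' : (Fin n → Fin (P + 1)) × (Fin n → Fin (P + 1)) × (Fin n → Fin (P + 1))}
    (hT : T ∈ 𝒯) (hT' : T' ∈ 𝒯) (hne : T' ≠ T) (h1 : T'.1 = T.1) : seqVal T'.2.1 ≠ seqVal T.2.1 := by
  intro h2
  apply hne
  have hJ : T'.2.1 = T.2.1 := funext fun t => Fin.ext (congrFun h2 t)
  have hK : T'.2.2 = T.2.2 := by
    funext t
    apply Fin.ext
    have a := h𝒯 T hT t
    have a' := h𝒯 T' hT' t
    rw [h1, hJ] at a'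
    simp only [seqVal] at a a'
    omega
  exact Prod.ext h1 (Prod.ext hJ hK)

/-- Two different triples of a level family sharing the `Y`-block have different `X`-blocks. [cite: VassilevskaWilliamsXuXuZhou2024, Claim 6.6] -/
theorem IsLevelFamily.fst_ne_of_snd_eq {𝒯 : Finset ((Fin n → Fin (P + 1)) × (Fin n → Fin (P + 1)) × (Fin n → Fin (P + 1)))}
    (h𝒯 : IsLevelFamily P 𝒯) {T T' : (Fin n → Fin (P + 1)) × (Fin n → Fin (P + 1)) × (Fin n → Fin (P + 1))}
    (hT : T ∈ 𝒯) (hT' : T' ∈ 𝒯) (hne : T' ≠ T) (h2 : T'.2.1 = T.2.1) : seqVal T'.1 ≠ seqVal T.1 := by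
  intro h1
  apply hne
  have hI : T'.1 = T.1 := funext fun t => Fin.ext (congrFun h1 t)
  have hK : T'.2.2 = T.2.2 := by
    funext t
    apply Fin.ext
    have a := h𝒯 T hT t
    have a' := h𝒯 T' hT' t
    rw [hI, h2] at a'
    simp only [seqVal] at a a'
    omega
  exact Prod.ext hI (Prod.ext h2 hK)

end LevelFamily

/-! ## Claim 6.6: bucket counts -/

section Buckets

variable {M n P : ℕ} [Fact M.Prime]
variable {𝒯 : Finset ((Fin n → Fin (P + 1)) × (Fin n → Fin (P + 1)) × (Fin n → Fin (P + 1)))}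

/-- **Claim 6.6, first part**: `M^n` of the `M^{n+2}` seeds put a level triple into bucket `b`
(probability `1/M²`). [cite: VassilevskaWilliamsXuXuZhou2024, Claim 6.6] -/
theorem IsLevelFamily.card_seeds_inBucket (h𝒯 : IsLevelFamily P 𝒯) (hM : M ≠ 2)
    {T : (Fin n → Fin (P + 1)) × (Fin n → Fin (P + 1)) × (Fin n → Fin (P + 1))} (hT : T ∈ 𝒯) (b : ZMod M) :
    (univ.filter fun ω : VxxzSeed M n => InBucket P ω T b).card = M ^ n := by
  have h := card_seeds_vxxzHash_bucket (n := n) hM (h𝒯 T hT) b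
  have hM2 : 0 < M ^ 2 := pow_pos (Nat.Prime.pos Fact.out) 2
  refine Nat.eq_of_mul_eq_mul_right hM2 ?_
  rw [show M ^ n * M ^ 2 = M ^ (n + 2) by ring, ← h]
  rfl

/-- **Claim 6.6, second part (`X`)**: `M^{n−1}` seeds put both `T` and another triple of the family
sharing `X_I` into bucket `b` (conditional probability `1/M`). [cite: VassilevskaWilliamsXuXuZhou2024, Claim 6.6] -/
theorem IsLevelFamily.card_seeds_inBucket_shareX (h𝒯 : IsLevelFamily P 𝒯) (hM : M ≠ 2) (hPM : P < M) (hn : 0 < n)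
    {T T' : (Fin n → Fin (P + 1)) × (Fin n → Fin (P + 1)) × (Fin n → Fin (P + 1))}
    (hT : T ∈ 𝒯) (hT' : T' ∈ 𝒯) (hne : T' ≠ T) (h1 : T'.1 = T.1) (b : ZMod M) :
    (univ.filter fun ω : VxxzSeed M n => InBucket P ω T b ∧ InBucket P ω T' b).card = M ^ (n - 1) := by
  have hJ := h𝒯.snd_ne_of_fst_eq hT hT' hne h1
  have h := card_seeds_vxxzHash_bucket_shareX (n := n) hM (h𝒯 T hT)
    (I := seqVal T.1) (J' := seqVal T'.2.1) (K' := seqVal T'.2.2)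
    (by intro t; have := h𝒯 T' hT' t; rw [h1] at this; exact this)
    (seqVal_lt hPM _) (seqVal_lt hPM _) hJ.symm b
  have hM3 : 0 < M ^ 3 := pow_pos (Nat.Prime.pos Fact.out) 3
  refine Nat.eq_of_mul_eq_mul_right hM3 ?_
  have hn' : n - 1 + 3 = n + 2 := by omega
  rw [← pow_add, hn', ← h]
  congr 2
  refine Finset.filter_congr fun ω _ => ?_
  simp only [InBucket, h1]

/-- **Claim 6.6, second part (`Y`).** [cite: VassilevskaWilliamsXuXuZhou2024, Claim 6.6 ("This also holds analogously for different block triples that share the same Y-block")] -/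
theorem IsLevelFamily.card_seeds_inBucket_shareY (h𝒯 : IsLevelFamily P 𝒯) (hM : M ≠ 2) (hPM : P < M) (hn : 0 < n)
    {T T' : (Fin n → Fin (P + 1)) × (Fin n → Fin (P + 1)) × (Fin n → Fin (P + 1))}
    (hT : T ∈ 𝒯) (hT' : T' ∈ 𝒯) (hne : T' ≠ T) (h2 : T'.2.1 = T.2.1) (b : ZMod M) :
    (univ.filter fun ω : VxxzSeed M n => InBucket P ω T b ∧ InBucket P ω T' b).card = M ^ (n - 1) := by
  have hI := h𝒯.fst_ne_of_snd_eq hT hT' hne h2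
  have h := card_seeds_vxxzHash_bucket_shareY (n := n) hM (h𝒯 T hT)
    (J := seqVal T.2.1) (I' := seqVal T'.1) (K' := seqVal T'.2.2)
    (by intro t; have := h𝒯 T' hT' t; rw [h2] at this; exact this)
    (seqVal_lt hPM _) (seqVal_lt hPM _) hI.symm b
  have hM3 : 0 < M ^ 3 := pow_pos (Nat.Prime.pos Fact.out) 3
  refine Nat.eq_of_mul_eq_mul_right hM3 ?_
  have hn' : n - 1 + 3 = n + 2 := by omega
  rw [← pow_add, hn', ← h]
  congr 2
  refine Finset.filter_congr fun ω _ => ?_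
  simp only [InBucket, h2]

end Buckets

/-! ## Claims 6.7 and 6.8: survival under the asymmetric cleanup -/

section Survival

variable {M n P : ℕ} [Fact M.Prime]
variable {𝒯 : Finset ((Fin n → Fin (P + 1)) × (Fin n → Fin (P + 1)) × (Fin n → Fin (P + 1)))}

/-- **VXXZ Claim 6.7** (survival probability `≥ 3/4`, counting form, for an arbitrary family of level
triples).  If `M` is an odd prime with `P < M`, `n ≥ 1`, and the triple `T ∈ 𝒯` has
`8 · deg_X(T) ≤ M` and `8 · deg_Y(T) ≤ M` (`deg_X(T) = #{T' ∈ 𝒯 | T'.1 = T.1}`; the requirement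
`M ≥ M₀ ≥ 8 · max{numtriple/numxblock, numtriple/numyblock}` once the degrees are uniform), then at
least `3/4` of the `M^n` seeds putting `T` into bucket `b` let it survive the cleanup:
`3 M^n ≤ 4 · #{ω | Survives 𝒯 ω T b}`. [cite: VassilevskaWilliamsXuXuZhou2024, Claim 6.7 (via the proof of Claim 5.6)] -/
theorem vxxz2024_claim67 (h𝒯 : IsLevelFamily P 𝒯) (hM : M ≠ 2) (hPM : P < M) (hn : 0 < n)
    {T : (Fin n → Fin (P + 1)) × (Fin n → Fin (P + 1)) × (Fin n → Fin (P + 1))} (hT : T ∈ 𝒯)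
    (hdegX : 8 * (𝒯.filter fun T' => T'.1 = T.1).card ≤ M)
    (hdegY : 8 * (𝒯.filter fun T' => T'.2.1 = T.2.1).card ≤ M) (b : ZMod M) :
    3 * M ^ n ≤ 4 * (univ.filter fun ω : VxxzSeed M n => Survives 𝒯 ω T b).card := by
  classical
  -- the seeds with `T` in bucket `b` split into survivors and the two kinds of collisions
  set S := univ.filter fun ω : VxxzSeed M n => Survives 𝒯 ω T b with hS
  set CX := univ.filter fun ω : VxxzSeed M n =>
    InBucket P ω T b ∧ ∃ T' ∈ 𝒯, T' ≠ T ∧ T'.1 = T.1 ∧ InBucket P ω T' b with hCX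
  set CY := univ.filter fun ω : VxxzSeed M n =>
    InBucket P ω T b ∧ ∃ T' ∈ 𝒯, T' ≠ T ∧ T'.2.1 = T.2.1 ∧ InBucket P ω T' b with hCY
  have hcover : (univ.filter fun ω : VxxzSeed M n => InBucket P ω T b) ⊆ S ∪ (CX ∪ CY) := by
    intro ω hω
    rw [mem_filter] at hω
    rw [mem_union, mem_union, hS, hCX, hCY, mem_filter, mem_filter, mem_filter]
    by_cases hx : ∃ T' ∈ 𝒯, T' ≠ T ∧ T'.1 = T.1 ∧ InBucket P ω T' b
    · exact Or.inr (Or.inl ⟨mem_univ _, hω.2, hx⟩)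
    by_cases hy : ∃ T' ∈ 𝒯, T' ≠ T ∧ T'.2.1 = T.2.1 ∧ InBucket P ω T' b
    · exact Or.inr (Or.inr ⟨mem_univ _, hω.2, hy⟩)
    refine Or.inl ⟨mem_univ _, hω.2, fun T' hT' hne h1 hb => hx ⟨T', hT', hne, h1, hb⟩,
      fun T' hT' hne h2 hb => hy ⟨T', hT', hne, h2, hb⟩⟩
  have hbucket : (univ.filter fun ω : VxxzSeed M n => InBucket P ω T b).card = M ^ n :=
    h𝒯.card_seeds_inBucket hM hT b
  -- union bounds for the collisions
  have hCXle : CX.card ≤ ((𝒯.filter fun T' => T'.1 = T.1).card - 1) * M ^ (n - 1) := by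
    have hsub : CX ⊆ ((𝒯.filter fun T' => T'.1 = T.1).erase T).biUnion fun T' =>
        univ.filter fun ω : VxxzSeed M n => InBucket P ω T b ∧ InBucket P ω T' b := by
      intro ω hω
      rw [hCX, mem_filter] at hω
      obtain ⟨-, hb, T', hT', hne, h1, hb'⟩ := hω
      rw [mem_biUnion]
      exact ⟨T', mem_erase.2 ⟨hne, mem_filter.2 ⟨hT', h1⟩⟩, mem_filter.2 ⟨mem_univ _, hb, hb'⟩⟩
    refine (card_le_card hsub).trans (card_biUnion_le.trans ?_)
    have hTmem : T ∈ 𝒯.filter (fun T' => T'.1 = T.1) := mem_filter.2 ⟨hT, rfl⟩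
    rw [← card_erase_of_mem hTmem, ← smul_eq_mul, ← sum_const]
    refine sum_le_sum fun T' hT' => ?_
    obtain ⟨hne, hT'⟩ := mem_erase.1 hT'
    obtain ⟨hT'𝒯, h1⟩ := mem_filter.1 hT'
    exact (h𝒯.card_seeds_inBucket_shareX hM hPM hn hT hT'𝒯 hne h1 b).le
  have hCYle : CY.card ≤ ((𝒯.filter fun T' => T'.2.1 = T.2.1).card - 1) * M ^ (n - 1) := by
    have hsub : CY ⊆ ((𝒯.filter fun T' => T'.2.1 = T.2.1).erase T).biUnion fun T' =>
        univ.filter fun ω : VxxzSeed M n => InBucket P ω T b ∧ InBucket P ω T' b := by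
      intro ω hω
      rw [hCY, mem_filter] at hω
      obtain ⟨-, hb, T', hT', hne, h2, hb'⟩ := hω
      rw [mem_biUnion]
      exact ⟨T', mem_erase.2 ⟨hne, mem_filter.2 ⟨hT', h2⟩⟩, mem_filter.2 ⟨mem_univ _, hb, hb'⟩⟩
    refine (card_le_card hsub).trans (card_biUnion_le.trans ?_)
    have hTmem : T ∈ 𝒯.filter (fun T' => T'.2.1 = T.2.1) := mem_filter.2 ⟨hT, rfl⟩
    rw [← card_erase_of_mem hTmem, ← smul_eq_mul, ← sum_const]
    refine sum_le_sum fun T' hT' => ?_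
    obtain ⟨hne, hT'⟩ := mem_erase.1 hT'
    obtain ⟨hT'𝒯, h2⟩ := mem_filter.1 hT'
    exact (h𝒯.card_seeds_inBucket_shareY hM hPM hn hT hT'𝒯 hne h2 b).le
  have hpow : M ^ (n - 1) * M = M ^ n := by
    rw [← pow_succ]; congr 1; omega
  have hCX8 : 8 * CX.card ≤ M ^ n := by
    calc 8 * CX.card ≤ 8 * (((𝒯.filter fun T' => T'.1 = T.1).card - 1) * M ^ (n - 1)) :=
          Nat.mul_le_mul_left _ hCXle
      _ ≤ 8 * ((𝒯.filter fun T' => T'.1 = T.1).card * M ^ (n - 1)) :=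
          Nat.mul_le_mul_left _ (Nat.mul_le_mul_right _ (Nat.sub_le _ _))
      _ = 8 * (𝒯.filter fun T' => T'.1 = T.1).card * M ^ (n - 1) := by ring
      _ ≤ M * M ^ (n - 1) := Nat.mul_le_mul_right _ hdegX
      _ = M ^ n := by rw [mul_comm, hpow]
  have hCY8 : 8 * CY.card ≤ M ^ n := by
    calc 8 * CY.card ≤ 8 * (((𝒯.filter fun T' => T'.2.1 = T.2.1).card - 1) * M ^ (n - 1)) :=
          Nat.mul_le_mul_left _ hCYle
      _ ≤ 8 * ((𝒯.filter fun T' => T'.2.1 = T.2.1).card * M ^ (n - 1)) :=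
          Nat.mul_le_mul_left _ (Nat.mul_le_mul_right _ (Nat.sub_le _ _))
      _ = 8 * (𝒯.filter fun T' => T'.2.1 = T.2.1).card * M ^ (n - 1) := by ring
      _ ≤ M * M ^ (n - 1) := Nat.mul_le_mul_right _ hdegY
      _ = M ^ n := by rw [mul_comm, hpow]
  -- assemble: `M^n ≤ |S| + |CX| + |CY|`
  have hle : M ^ n ≤ S.card + (CX.card + CY.card) := by
    rw [← hbucket]
    exact (card_le_card hcover).trans ((card_union_le _ _).trans
      (Nat.add_le_add_left (card_union_le _ _) _))
  omega

/-- **VXXZ Claim 6.8** (expected number of surviving triples, counting form): for `𝒯α ⊆ 𝒯` (the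
triples consistent with `{α_t}`) all of whose members obey the degree bounds, and the buckets `b ∈ B`,
`3 |B| |𝒯α| M^n ≤ 4 ∑_ω #{(b,T) ∈ B × 𝒯α | Survives 𝒯 ω T b}` — the expectation over the `M^{n+2}`
seeds is `≥ (3/4) |B| |𝒯α| / M² = numalpha · M₀^{−1−o(1)}`. [cite: VassilevskaWilliamsXuXuZhou2024, Claim 6.8 (via Claim 5.7)] -/
theorem vxxz2024_claim68 (h𝒯 : IsLevelFamily P 𝒯) (hM : M ≠ 2) (hPM : P < M) (hn : 0 < n)
    {𝒯α : Finset ((Fin n → Fin (P + 1)) × (Fin n → Fin (P + 1)) × (Fin n → Fin (P + 1)))} (h𝒯α : 𝒯α ⊆ 𝒯)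
    (hdegX : ∀ T ∈ 𝒯α, 8 * (𝒯.filter fun T' => T'.1 = T.1).card ≤ M)
    (hdegY : ∀ T ∈ 𝒯α, 8 * (𝒯.filter fun T' => T'.2.1 = T.2.1).card ≤ M) (B : Finset (ZMod M)) :
    3 * (B.card * 𝒯α.card * M ^ n) ≤ 4 * ∑ ω : VxxzSeed M n,
      ((B ×ˢ 𝒯α).filter fun bT => Survives 𝒯 ω bT.2 bT.1).card := by
  classical
  have hswap : ∑ ω : VxxzSeed M n, ((B ×ˢ 𝒯α).filter fun bT => Survives 𝒯 ω bT.2 bT.1).card =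
      ∑ bT ∈ B ×ˢ 𝒯α, (univ.filter fun ω : VxxzSeed M n => Survives 𝒯 ω bT.2 bT.1).card := by
    simp only [card_filter]
    rw [sum_comm]
  rw [hswap, mul_sum]
  calc 3 * (B.card * 𝒯α.card * M ^ n) = ∑ _bT ∈ B ×ˢ 𝒯α, 3 * M ^ n := by
        rw [sum_const, card_product, smul_eq_mul]; ring
    _ ≤ ∑ bT ∈ B ×ˢ 𝒯α, 4 * (univ.filter fun ω : VxxzSeed M n => Survives 𝒯 ω bT.2 bT.1).card :=
        sum_le_sum fun bT hbT => vxxz2024_claim67 h𝒯 hM hPM hn (h𝒯α (mem_product.1 hbT).2)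
          (hdegX _ (mem_product.1 hbT).2) (hdegY _ (mem_product.1 hbT).2) bT.1

/-- **Claim 6.8, existence of a good seed**: `∃ ω, 3 |B| |𝒯α| ≤ 4 M² · #{T ∈ 𝒯α | T survives in some bucket b ∈ B}`.
[cite: VassilevskaWilliamsXuXuZhou2024, Claim 6.8] -/
theorem vxxz2024_claim68_exists (h𝒯 : IsLevelFamily P 𝒯) (hM : M ≠ 2) (hPM : P < M) (hn : 0 < n)
    {𝒯α : Finset ((Fin n → Fin (P + 1)) × (Fin n → Fin (P + 1)) × (Fin n → Fin (P + 1)))} (h𝒯α : 𝒯α ⊆ 𝒯)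
    (hdegX : ∀ T ∈ 𝒯α, 8 * (𝒯.filter fun T' => T'.1 = T.1).card ≤ M)
    (hdegY : ∀ T ∈ 𝒯α, 8 * (𝒯.filter fun T' => T'.2.1 = T.2.1).card ≤ M) (B : Finset (ZMod M)) :
    ∃ ω : VxxzSeed M n, 3 * (B.card * 𝒯α.card) ≤ 4 * M ^ 2 *
      (𝒯α.filter fun T => ∃ b ∈ B, Survives 𝒯 ω T b).card := by
  classical
  have hsum := vxxz2024_claim68 h𝒯 hM hPM hn h𝒯α hdegX hdegY B
  simp only [card_filter_product_survives_eq] at hsum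
  by_contra hcon
  simp only [not_exists, not_le] at hcon
  have hlt : ∑ ω : VxxzSeed M n, 4 * M ^ 2 * (𝒯α.filter fun T => ∃ b ∈ B, Survives 𝒯 ω T b).card <
      ∑ _ω : VxxzSeed M n, 3 * (B.card * 𝒯α.card) :=
    sum_lt_sum_of_nonempty univ_nonempty fun ω _ => hcon ω
  rw [sum_const, card_univ, card_vxxzSeed, smul_eq_mul, ← mul_sum] at hlt
  have : M ^ (n + 2) * (3 * (B.card * 𝒯α.card)) ≤ 4 * M ^ 2 *
      ∑ ω : VxxzSeed M n, (𝒯α.filter fun T => ∃ b ∈ B, Survives 𝒯 ω T b).card := by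
    calc M ^ (n + 2) * (3 * (B.card * 𝒯α.card)) = M ^ 2 * (3 * (B.card * 𝒯α.card * M ^ n)) := by ring
      _ ≤ M ^ 2 * (4 * ∑ ω : VxxzSeed M n, (𝒯α.filter fun T => ∃ b ∈ B, Survives 𝒯 ω T b).card) :=
          Nat.mul_le_mul_left _ hsum
      _ = _ := by ring
  exact absurd (lt_of_le_of_lt this hlt) (lt_irrefl _)

end Survival

/-! ## The present triples of a level family -/

section Present

variable {M n P : ℕ} [Fact M.Prime]
variable {𝒯 : Finset ((Fin n → Fin (P + 1)) × (Fin n → Fin (P + 1)) × (Fin n → Fin (P + 1)))}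

/-- In a 3-AP-free `B`, a hash-present triple of a level family lies in the bucket `h_X(I)`. [cite: VassilevskaWilliamsXuXuZhou2024, §6.2 ("all remaining block triples are contained in a bucket b for some b ∈ B")] -/
theorem IsLevelFamily.inBucket_of_mem_hashPresent (h𝒯 : IsLevelFamily P 𝒯) (hM : M ≠ 2) {ω : VxxzSeed M n}
    {B : Finset (ZMod M)} (hB : ThreeAPFree (B : Set (ZMod M)))
    {T : (Fin n → Fin (P + 1)) × (Fin n → Fin (P + 1)) × (Fin n → Fin (P + 1))} (hT : T ∈ hashPresent P 𝒯 ω B) :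
    InBucket P ω T (vxxzHashX ω (seqVal T.1)) := by
  obtain ⟨hT𝒯, hX, hY, hZ⟩ := mem_hashPresent.1 hT
  have h := vxxzHash_eq_of_threeAPFree hM hB ω (h𝒯 T hT𝒯) (mem_coe.2 hX) (mem_coe.2 hY) (mem_coe.2 hZ)
  exact ⟨rfl, h.2.trans h.1.symm, h.1.symm⟩

/-- **The present triples of a level family are the `α`-consistent triples surviving the cleanup in
some bucket of `B`** (3-AP-free `B`, odd prime `M`). [cite: VassilevskaWilliamsXuXuZhou2024, §6.2 (the cleanup, 𝒯') and Claims 6.7–6.8] -/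
theorem IsLevelFamily.presentTriples_eq_filter_survives (h𝒯 : IsLevelFamily P 𝒯) (hM : M ≠ 2)
    {𝒯α : Finset ((Fin n → Fin (P + 1)) × (Fin n → Fin (P + 1)) × (Fin n → Fin (P + 1)))} (h𝒯α : 𝒯α ⊆ 𝒯)
    (ω : VxxzSeed M n) {B : Finset (ZMod M)} (hB : ThreeAPFree (B : Set (ZMod M))) :
    presentTriples P 𝒯 𝒯α ω B = 𝒯α.filter fun T => ∃ b ∈ B, Survives 𝒯 ω T b := by
  classical
  ext T
  rw [mem_presentTriples, mem_filter, mem_keptX, mem_keptY, mem_keptZ]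
  constructor
  · rintro ⟨hT, ⟨-, hXB, T₁, hT₁α, hT₁p, hT₁I, huX⟩, ⟨-, hYB, T₂, -, -, -, huY⟩, -, hZB⟩
    have hTp : T ∈ hashPresent P 𝒯 ω B := mem_hashPresent.2 ⟨hT, hXB, hYB, hZB⟩
    have hT1 : T = T₁ := huX T hTp rfl
    have hT2 : T = T₂ := huY T hTp rfl
    refine ⟨hT1 ▸ hT₁α, vxxzHashX ω (seqVal T.1), hXB, h𝒯.inBucket_of_mem_hashPresent hM hB hTp, ?_, ?_⟩
    · intro T' hT' hne h1 hb
      exact hne ((huX T' (mem_hashPresent_of_inBucket hXB hT' hb) h1).trans hT1.symm)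
    · intro T' hT' hne h2 hb
      exact hne ((huY T' (mem_hashPresent_of_inBucket hXB hT' hb) h2).trans hT2.symm)
  · rintro ⟨hTα, b, hb, hin, huX, huY⟩
    have hT : T ∈ 𝒯 := h𝒯α hTα
    have hTp : T ∈ hashPresent P 𝒯 ω B := mem_hashPresent_of_inBucket hb hT hin
    obtain ⟨hXb, hYb, hZb⟩ := hin
    have hbX : b = vxxzHashX ω (seqVal T.1) := hXb.symm
    refine ⟨hT, ⟨⟨T, hT, rfl⟩, by rw [hXb]; exact hb, T, hTα, hTp, rfl, fun T' hT'p h1 => ?_⟩,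
      ⟨⟨T, hT, rfl⟩, by rw [hYb]; exact hb, T, hTα, hTp, rfl, fun T' hT'p h2 => ?_⟩,
      ⟨T, hT, rfl⟩, by rw [hZb]; exact hb⟩
    · by_contra hne
      have hin' := h𝒯.inBucket_of_mem_hashPresent hM hB hT'p
      rw [h1, ← hbX] at hin'
      exact huX T' (mem_hashPresent.1 hT'p).1 hne h1 hin'
    · by_contra hne
      have hin' := h𝒯.inBucket_of_mem_hashPresent hM hB hT'p
      have hb' : vxxzHashX ω (seqVal T'.1) = b := by
        have e := hin'.2.1
        rw [h2, hYb] at e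
        exact e.symm
      rw [hb'] at hin'
      exact huY T' (mem_hashPresent.1 hT'p).1 hne h2 hin'

end Present

end Literature.Computability.AlgebraicComplexity
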